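import Summits.QuantumAdvantage.QuantumAdvantage.Theorems.IndexDialSparseBridgeA
import HarnessLib

/-!
# The SPARSE BRIDGE, part B: the odd-class currency and the tower OFFER «assume `n = 8b·3^j`»
(supports the ring-hardness items of the `p = 3` leaf, e.g. stmt-QuantumAdvantage-27380; parametric in the prime `p`)

Cell decomp-qadv, seat lens-5, generation 18 — tree twin of §1 (odd-class part) / §2 / §4 of the generation-17 node `IndexDial`
(critic row 74v7).  NO NEW `Prop`.  Part A (`Theorems.IndexDialSparseBridgeA`) proves the all-pattern sparse bridge
`hlfNotFAC0Mod_of_hardOn` / `adviceFreeQNC0Sep_of_hardOn` and the pointwise give-away `card_rel_le_of_odd`; here: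

* `hardOn_of_oddHardOn`, `adviceFreeQNC0Sep_of_oddHardOn` — the odd-class currency (`RingHardOdd`-shape) at the lengths `8t`,
  `t ∈ S`, `S` Dense-3, suffices for `AdviceFreeQNC0Sep p`.
* `dense3_tower` — every geometric tower `{b·3^j}` (`b ≥ 1`) is Dense-3; hence the OFFER
  `adviceFreeQNC0Sep_of_oddHard_tower` / `adviceFreeQNC0Three_of_oddHard_tower` ★: a prover of ring hardness for the leaf
  may assume the ring length is `n = 8b·3^j` (any fixed base `b ≥ 1`; `b = 2`: `n = 16·3^j`) for all large `j`, at no cost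
  to the leaf; `oddHard_tower_of_ringHardOdd` records that this hypothesis is WEAKER than `RingHardOdd p` by name, and
  `adviceFreeQNC0Three_of_ringHardOdd'` recovers the registered alternative closer.
-/

set_option linter.dupNamespace false

noncomputable section

open scoped Classical

namespace Summit.QuantumAdvantage.QuantumAdvantage.Theorems.IndexDial

open Finset Polynomial
open Literature.Computability.Cryptography Literature.Computability.Complexity
open Literature.Computability.QuantumComplexity Literature.Computability.MetaComplexity
open Summit.QuantumAdvantage.AdviceFreeQNC0
open Summit.QuantumAdvantage.QuantumAdvantage.Theorems

/-! ## §3 The odd-class currency on a sparse set of lengths -/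

/-- ODD-CLASS hardness (threshold `θ`, every polylog degree) at the lengths `8t`, `t ∈ S` (for all large such `t`) gives
ALL-PATTERN hardness there with threshold `(1+θ)/2` — `card_rel_le_of_odd` at each length. -/
theorem hardOn_of_oddHardOn {p : ℕ} [Fact p.Prime] {S : Set ℕ}
    (h : ∃ θ : ℝ, θ < 1 ∧ ∀ c : ℕ, ∃ t₀ : ℕ, ∀ t ≥ t₀, t ∈ S →
      ∀ P : Fin (8 * t) → Smolensky.CubeFn (ZMod p) (8 * t),
        (∀ i, P i ∈ Smolensky.lowDeg (ZMod p) (8 * t) ((Nat.log 2 (8 * t)) ^ c)) →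
        ((univ.filter fun x : Fin (8 * t) → Bool =>
            OddZeros x ∧ RingHLF.Rel x (fun i => decide (P i x = 1))).card : ℝ) ≤ θ * (2 : ℝ) ^ (8 * t - 1)) :
    ∃ θ : ℝ, θ < 1 ∧ ∀ c : ℕ, ∃ t₀ : ℕ, ∀ t ≥ t₀, t ∈ S →
      ∀ P : Fin (8 * t) → Smolensky.CubeFn (ZMod p) (8 * t),
        (∀ i, P i ∈ Smolensky.lowDeg (ZMod p) (8 * t) ((Nat.log 2 (8 * t)) ^ c)) →
        ((univ.filter fun x : Fin (8 * t) → Bool =>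
            RingHLF.Rel x (fun i => decide (P i x = 1))).card : ℝ) ≤ θ * (2 : ℝ) ^ (8 * t) := by
  obtain ⟨θ, hθ, hh⟩ := h
  refine ⟨(1 + θ) / 2, by linarith, fun c => ?_⟩
  obtain ⟨t₀, ht₀⟩ := hh c
  refine ⟨max t₀ 1, fun t ht htS P hP => ?_⟩
  have ht1 : 1 ≤ t := le_trans (le_max_right _ _) ht
  have hodd := ht₀ t (le_trans (le_max_left _ _) ht) htS P hP
  exact card_rel_le_of_odd (by omega) P hodd

/-- ★ odd-class ring hardness on any Dense-3 set of multipliers gives the advice-free separation. -/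
theorem adviceFreeQNC0Sep_of_oddHardOn (p : ℕ) [Fact p.Prime] {S : Set ℕ}
    (hS : ∃ T₀ : ℕ, ∀ T ≥ T₀, ∃ t ∈ S, t ≤ T ∧ T ≤ 3 * t)
    (h : ∃ θ : ℝ, θ < 1 ∧ ∀ c : ℕ, ∃ t₀ : ℕ, ∀ t ≥ t₀, t ∈ S →
      ∀ P : Fin (8 * t) → Smolensky.CubeFn (ZMod p) (8 * t),
        (∀ i, P i ∈ Smolensky.lowDeg (ZMod p) (8 * t) ((Nat.log 2 (8 * t)) ^ c)) →
        ((univ.filter fun x : Fin (8 * t) → Bool =>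
            OddZeros x ∧ RingHLF.Rel x (fun i => decide (P i x = 1))).card : ℝ) ≤ θ * (2 : ℝ) ^ (8 * t - 1)) :
    AdviceFreeQNC0Sep p :=
  adviceFreeQNC0Sep_of_hardOn p hS (hardOn_of_oddHardOn h)

/-! ## §4 Geometric towers are Dense-3; the OFFER «assume `n = 8b·3^j`» -/

/-- every geometric tower `{b·3^j : j}` with `b ≥ 1` is Dense-3 (consecutive ratio `3`): take `t := b·3^{⌊log₃ (T/b)⌋}`. -/
theorem dense3_tower {b : ℕ} (hb : 1 ≤ b) :
    ∃ T₀ : ℕ, ∀ T ≥ T₀, ∃ t ∈ ({t | ∃ j : ℕ, t = b * 3 ^ j} : Set ℕ), t ≤ T ∧ T ≤ 3 * t := by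
  refine ⟨b, fun T hT => ?_⟩
  refine ⟨b * 3 ^ Nat.log 3 (T / b), ⟨Nat.log 3 (T / b), rfl⟩, ?_, ?_⟩
  · have h1 : 3 ^ Nat.log 3 (T / b) ≤ T / b :=
      Nat.pow_log_le_self 3 (Nat.div_pos hT (by omega)).ne'
    calc b * 3 ^ Nat.log 3 (T / b) ≤ b * (T / b) := Nat.mul_le_mul_left b h1
      _ ≤ T := Nat.mul_div_le T b
  · have h2 : T / b < 3 ^ (Nat.log 3 (T / b)).succ := Nat.lt_pow_succ_log_self (by norm_num) (T / b)
    have h3 : T < b * (T / b + 1) := Nat.lt_mul_div_succ T (by omega)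
    have h4 : b * (T / b + 1) ≤ b * 3 ^ (Nat.log 3 (T / b)).succ := Nat.mul_le_mul_left b h2
    have h5 : b * 3 ^ (Nat.log 3 (T / b)).succ = 3 * (b * 3 ^ Nat.log 3 (T / b)) := by
      rw [pow_succ]; ring
    omega

/-- on a tower, «for all large `j`» is «for all large tower elements»: if `b·3^j ≥ b·3^{j₀}` then `j ≥ j₀` (`b ≥ 1`). -/
theorem le_of_tower_le {b j j₀ : ℕ} (hb : 1 ≤ b) (h : b * 3 ^ j₀ ≤ b * 3 ^ j) : j₀ ≤ j := by
  by_contra hcon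
  have hlt : 3 ^ j < 3 ^ j₀ := Nat.pow_lt_pow_right (by norm_num) (by omega)
  have : b * 3 ^ j < b * 3 ^ j₀ := Nat.mul_lt_mul_of_pos_left hlt (by omega)
  omega

/-- ★ **THE OFFER** (parametric in the prime `p` and the base `b ≥ 1`): ODD-CLASS ring hardness ALONG THE TOWER of lengths
`8·(b·3^j)` — some `θ < 1` such that for every `c`, for all large `j`, every `𝔽_p`-strategy of degree `≤ (log₂ n)^c`, `n = 8(b·3^j)`,
solves the ring relation on at most `θ·2^(n−1)` odd-class patterns — ALREADY gives `AdviceFreeQNC0Sep p`.  Every prover of ring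
hardness may therefore assume `n = 8b·3^j` at no cost to the leaf. -/
theorem adviceFreeQNC0Sep_of_oddHard_tower (p : ℕ) [Fact p.Prime] {b : ℕ} (hb : 1 ≤ b)
    (h : ∃ θ : ℝ, θ < 1 ∧ ∀ c : ℕ, ∃ j₀ : ℕ, ∀ j ≥ j₀,
      ∀ P : Fin (8 * (b * 3 ^ j)) → Smolensky.CubeFn (ZMod p) (8 * (b * 3 ^ j)),
        (∀ i, P i ∈ Smolensky.lowDeg (ZMod p) (8 * (b * 3 ^ j)) ((Nat.log 2 (8 * (b * 3 ^ j))) ^ c)) →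
        ((univ.filter fun x : Fin (8 * (b * 3 ^ j)) → Bool =>
            OddZeros x ∧ RingHLF.Rel x (fun i => decide (P i x = 1))).card : ℝ) ≤ θ * (2 : ℝ) ^ (8 * (b * 3 ^ j) - 1)) :
    AdviceFreeQNC0Sep p := by
  obtain ⟨θ, hθ, hh⟩ := h
  refine adviceFreeQNC0Sep_of_oddHardOn p (S := {t | ∃ j : ℕ, t = b * 3 ^ j}) (dense3_tower hb) ⟨θ, hθ, fun c => ?_⟩
  obtain ⟨j₀, hj₀⟩ := hh c
  refine ⟨b * 3 ^ j₀, fun t ht htS P hP => ?_⟩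
  obtain ⟨j, rfl⟩ := htS
  exact hj₀ j (le_of_tower_le hb ht) P hP

/-- ★ the OFFER at `p = 3`, concluding the registered leaf `AdviceFreeQNC0Three` (rung F-Q1-p3) BY NAME: odd-class ring hardness
along any tower `n = 8b·3^j` (`b ≥ 1`; `b = 2` is `n = 16·3^j`) suffices. -/
theorem adviceFreeQNC0Three_of_oddHard_tower {b : ℕ} (hb : 1 ≤ b)
    (h : ∃ θ : ℝ, θ < 1 ∧ ∀ c : ℕ, ∃ j₀ : ℕ, ∀ j ≥ j₀,
      ∀ P : Fin (8 * (b * 3 ^ j)) → Smolensky.CubeFn (ZMod 3) (8 * (b * 3 ^ j)),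
        (∀ i, P i ∈ Smolensky.lowDeg (ZMod 3) (8 * (b * 3 ^ j)) ((Nat.log 2 (8 * (b * 3 ^ j))) ^ c)) →
        ((univ.filter fun x : Fin (8 * (b * 3 ^ j)) → Bool =>
            OddZeros x ∧ RingHLF.Rel x (fun i => decide (P i x = 1))).card : ℝ) ≤ θ * (2 : ℝ) ^ (8 * (b * 3 ^ j) - 1)) :
    AdviceFreeQNC0Three :=
  adviceFreeQNC0Three_iff.mpr (adviceFreeQNC0Sep_of_oddHard_tower 3 hb h)

/-- the tower hypothesis of the OFFER is WEAKER than the cell's crux `RingHardOdd p`, by name (restriction to the tower lengths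
`8·(b·3^j) ≥ j`). -/
theorem oddHard_tower_of_ringHardOdd (p : ℕ) [Fact p.Prime] {b : ℕ} (hb : 1 ≤ b) (h : RingHardOdd p) :
    ∃ θ : ℝ, θ < 1 ∧ ∀ c : ℕ, ∃ j₀ : ℕ, ∀ j ≥ j₀,
      ∀ P : Fin (8 * (b * 3 ^ j)) → Smolensky.CubeFn (ZMod p) (8 * (b * 3 ^ j)),
        (∀ i, P i ∈ Smolensky.lowDeg (ZMod p) (8 * (b * 3 ^ j)) ((Nat.log 2 (8 * (b * 3 ^ j))) ^ c)) →
        ((univ.filter fun x : Fin (8 * (b * 3 ^ j)) → Bool =>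
            OddZeros x ∧ RingHLF.Rel x (fun i => decide (P i x = 1))).card : ℝ) ≤ θ * (2 : ℝ) ^ (8 * (b * 3 ^ j) - 1) := by
  obtain ⟨θ, hθ, hh⟩ := h
  refine ⟨θ, hθ, fun c => ?_⟩
  obtain ⟨n₀, hn₀⟩ := hh c
  refine ⟨n₀, fun j hj P hP => hn₀ _ ?_ P hP⟩
  have h3 : j < 3 ^ j := Nat.lt_pow_self (by norm_num)
  have hb3 : 3 ^ j ≤ 8 * (b * 3 ^ j) := by nlinarith [Nat.one_le_pow j 3 (by norm_num)]
  omega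


/-- CONSISTENCY at `p = 3`: the offer composed with its necessity recovers the registered alternative closer
`adviceFreeQNC0Three_of_ringHardOdd : RingHardOdd 3 → AdviceFreeQNC0Three` (tower of base `1`, lengths `8·3^j`). -/
theorem adviceFreeQNC0Three_of_ringHardOdd' (h : RingHardOdd 3) : AdviceFreeQNC0Three :=
  adviceFreeQNC0Three_of_oddHard_tower (b := 1) le_rfl (oddHard_tower_of_ringHardOdd 3 le_rfl h)

end Summit.QuantumAdvantage.QuantumAdvantage.Theorems.IndexDial
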